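import Literature.NumberTheory.EllipticCurves.HeegnerEnvelopeLayerTwistProofs
import Literature.NumberTheory.EllipticCurves.HeegnerCharIdealScalingTransferProofs
import Literature.NumberTheory.EllipticCurves.LambdaAdicSelmerDataLevelProofs
import HarnessLib

/-!
# The Heegner-module envelope, REVERSE direction and the TORSION clause: `(ω_δ·p^e) · Λκ_∞(C) ⊆ ℋ_∞(F)`
# from the levelwise membership `p^e·κ_k ∈ ℋ̄_k(F)` (`k > δ`), and then `𝔖/ℋ_∞(F)` is torsion
# (bookkeeping for CGLS 2022 Thm. 4.1.1 / Rem. 4.1.4; proofs file)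

Topic `NumberTheory/EllipticCurves`. THEOREMS ONLY (no definition, no named fact, no `sorry`); sequel of
`HeegnerEnvelopeLevelwiseProofs` / `HeegnerEnvelopeUnitTwistProofs`. Written by the cell `bsd-print-x9` seat
`bsd-line-x9-p2` for the TORSION clause `Module.IsTorsion Λ (𝔖 ⧸ ℋ_∞(F))` of the stub `stub_envelopeTied` of
crux stmt-BirchSwinnertonDyer-26359 `PrintX9.HowardContainmentLightFramePinnedOfPrint`. The torsion of
`𝔖/ℋ_∞(F)` (the tree family's Heegner module has full rank) is NOT a statement about `ℋ ⊆ Λκ` but about the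
REVERSE inclusion: it follows from (i) `𝔖` torsion-free of `Λ`-rank one and `Λκ_∞(C) ≠ 0` — CGLS 2022
Thm. 4.1.1 (`κ₁^{Hg} ≠ 0`, Cornut–Vatsal) + §3.3, typed by the cell's lit seat as
`CastellaGrossiLeeSkinner2022.thm411_…` — and (ii) `g · Λκ_∞(C) ⊆ ℋ_∞(F)` for SOME `g ≠ 0` in `Λ`. For (ii)
the layers `k ≤ δ` — where `Λκ_∞(C)` imposes nothing and the tree family's thin level modules
`ℤ_p[G_k]·{y_K, z_0, …, z_k}` need not contain the norms of the stabilised classes — are disposed of by the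
factor `ω_δ = (1+T)^{p^δ} − 1`, which KILLS every layer `k ≤ δ`; above `δ` one needs exactly the levelwise
REVERSE membership `p^e·κ_k ∈ ℋ̄_k(F)` (geometric half: coherent points, `κ_k` is a unit multiple of `z_k`
modulo lower terms — seat x9-p1), which is the INPUT `hlev` here.

WHAT.
* §1 `padicPi_mem_heegnerModuleLayer`, `conjPi_pow_mem_heegnerModuleLayer`, `zsmul_mem_heegnerModuleLayer` —
  `ℋ̄_k(F)` is `ℤ_p[Gal(K_k/K)]`-stable.
* §2 `proj_one_add_X_pow_pow_sub_one_smul_of_le` — `proj_k (ω_n • t) = 0` for `k ≤ n` (`γ^{p^n} ∈ Gal(K̄/K_n) ≤ Gal(K̄/K_k)`).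
* §3 `omega_mul_pow_smul_stabilizedHeegnerModule_le_heegnerModule_of_levelwise` — REVERSE levelwise ⟹ Λ-adic:
  if `p^e • x ∈ ℋ̄_k(F)` for every `k > δ` and every `x ∈ ℤ_p[G_k]·κ_k(C)`, then
  `(ω_δ · p^e) • Λκ_∞(C) ≤ ℋ_∞(F)`; `…_of_generators`: it suffices that `p^e • x ∈ ℋ̄_k(F)` for the
  representatives `x` of `δ(κ_k)` (`stabilizedClassLayer`).
* §4 `isTorsion_quotient_of_smul_le` — for `𝔖` finitely generated torsion-free of `finrank 1`, submodules
  `M ≠ ⊥`, `H`, and `g ≠ 0` with `g • M ≤ H`: `𝔖/H` is torsion; `isTorsion_quotient_heegnerModule_of_levelwise`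
  — the torsion clause from `hlev`, `Λκ_∞(C) ≠ ⊥`, torsion-freeness and rank one.
HONEST FRAMING: bookkeeping only; nothing about any particular curve; BSD is not proved by any of this.

References: [CastellaGrossiLeeSkinner2022] Thm. 4.1.1 (κ₁^{Hg} ≠ 0), Rem. 4.1.4, §3.3 (torsion-freeness);
[PerrinRiou1987BSMF] §1 p. 405 («I(H_∞) non nul ssi H_∞ et 𝔖_p(D_∞) sont de même rang 1»), §3.4;
[Washington1997] §13.2 (ω_n); [Howard2004HeegnerKolyvagin] §3.3, Thm. 3.3.7.
-/

set_option autoImplicit false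

noncomputable section

open scoped Classical Pointwise

open WeierstrassCurve Literature.NumberTheory.EllipticCurves
  Literature.NumberTheory.EllipticCurves.CastellaGrossiLeeSkinner2022 PowerSeries

universe u

namespace Literature.NumberTheory.EllipticCurves

/-! ## §1 `ℋ̄_k(F)` is `ℤ_p[Gal(K_k/K)]`-stable -/

section HeegnerLayer

variable {N : ℕ} [NeZero N] {W : WeierstrassCurve ℚ} {K : Type u} [Field K] [NumberField K] {p : ℕ}
  [Fact p.Prime] {κ : ZpExtension K p} (γ : Field.absoluteGaloisGroup K) {jbar : AlgebraicClosure K →+* ℂ}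
  (F : HeegnerFamily N W K κ jbar) (k : ℕ)

/-- `ℋ̄_k(F)` is stable under `c ·`, `c ∈ ℤ_p` (`padicPi_padicPi` on generators).
[cite: Howard2004HeegnerKolyvagin, §3.3 (H_k = ℤ_p[Gal(K_k/K)]·{y_K, z_0, …, z_k})] -/
theorem padicPi_mem_heegnerModuleLayer (c : ℤ_[p])
    {y : (W.baseChange K).torsionH1Pi p (κ.layerSubgroup k)} (hy : y ∈ heegnerModuleLayer γ F k) :
    (W.baseChange K).padicPi p (κ.layerSubgroup k) c y ∈ heegnerModuleLayer γ F k := by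
  unfold heegnerModuleLayer at hy ⊢
  induction hy using AddSubgroup.closure_induction with
  | mem z hz =>
    obtain ⟨c', i, w, hw, d, hd, rfl⟩ := hz
    refine AddSubgroup.subset_closure ⟨c * c', i, w, hw, d, hd, ?_⟩
    rw [padicPi_padicPi]
  | zero => rw [map_zero]; exact AddSubgroup.zero_mem _
  | add a b _ _ ha hb => rw [map_add]; exact AddSubgroup.add_mem _ ha hb
  | neg a _ ha => rw [map_neg]; exact AddSubgroup.neg_mem _ ha

/-- `ℋ̄_k(F)` is stable under `n ·`, `n ∈ ℤ`. [cite: Howard2004HeegnerKolyvagin, §3.3 (H_k)] -/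
theorem zsmul_mem_heegnerModuleLayer (n : ℤ)
    {y : (W.baseChange K).torsionH1Pi p (κ.layerSubgroup k)} (hy : y ∈ heegnerModuleLayer γ F k) :
    n • y ∈ heegnerModuleLayer γ F k := by
  rw [← padicPi_intCast]
  exact padicPi_mem_heegnerModuleLayer γ F k _ hy

/-- `ℋ̄_k(F)` is stable under `conj_{γ^j}`. [cite: Howard2004HeegnerKolyvagin, §3.3 (H_k is a Gal(K_k/K)-module)] -/
theorem conjPi_pow_mem_heegnerModuleLayer [(κ.layerSubgroup k).Normal] (j : ℕ)
    {y : (W.baseChange K).torsionH1Pi p (κ.layerSubgroup k)} (hy : y ∈ heegnerModuleLayer γ F k) :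
    (W.baseChange K).conjPi p (κ.layerSubgroup k) (γ ^ j) y ∈ heegnerModuleLayer γ F k := by
  unfold heegnerModuleLayer at hy ⊢
  induction hy using AddSubgroup.closure_induction with
  | mem z hz =>
    obtain ⟨c, i, w, hw, d, hd, rfl⟩ := hz
    refine AddSubgroup.subset_closure ⟨c, j + i, w, hw, d, hd, ?_⟩
    rw [conjPi_padicPi_comm, conjPi_pow_add]
  | zero => rw [map_zero]; exact AddSubgroup.zero_mem _
  | add a b _ _ ha hb => rw [map_add]; exact AddSubgroup.add_mem _ ha hb
  | neg a _ ha => rw [map_neg]; exact AddSubgroup.neg_mem _ ha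

end HeegnerLayer

/-! ## §2 `ω_n = (1+T)^{p^n} − 1` kills every layer `k ≤ n` -/

section Omega

variable {K : Type u} [Field K] [NumberField K] {W : WeierstrassCurve K} {p : ℕ} [Fact p.Prime]
  {κ : ZpExtension K p} {γ : Field.absoluteGaloisGroup K} (D : W.LambdaAdicSelmerData κ γ)

/-- `proj_k (ω_n • t) = 0` for `k ≤ n`: `ω_n = (1+T)^{p^n} − 1` acts as `conj_{γ^{p^n}} − 1`, and
`γ^{p^n} ∈ Gal(K̄/K_n) ≤ Gal(K̄/K_k)` acts trivially on `H¹(K_k, ·)`.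
[cite: Washington1997, §13.2 (ω_n, Λ/ω_n ≅ ℤ_p[Γ/Γ_n])] -/
theorem proj_one_add_X_pow_pow_sub_one_smul_of_le (hγ : κ.IsTopGenerator γ) {k n : ℕ} (hkn : k ≤ n)
    (t : D.S) :
    D.proj k ((((1 + PowerSeries.X : IwasawaAlgebra p) ^ (p ^ n)) - 1) • t) = 0 := by
  rw [sub_smul, one_smul, map_sub, proj_one_add_X_pow_smul, sub_eq_zero]
  funext m
  simp only [conjPi, AddMonoidHom.pi_apply, AddMonoidHom.coe_comp, Function.comp_apply,
    Pi.evalAddMonoidHom_apply]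
  rw [conjH1_of_mem_holds (κ.layerSubgroup k) (geomTorsion W ((p : ℤ) ^ m))
    (κ.layerSubgroup_antitone hkn
      (WeierstrassCurve.LambdaAdicSelmerDataExists.pow_mem_layerSubgroup p κ hγ n)),
    AddMonoidHom.id_apply]

end Omega

/-! ## §3 REVERSE levelwise ⟹ Λ-adic, with the factor `ω_δ` -/

section Reverse

variable {N : ℕ} [NeZero N] {W : WeierstrassCurve ℚ} [W.IsGloballyMinimal] {K : Type u} [Field K]
  [NumberField K] {p : ℕ} [Fact p.Prime] {κ : ZpExtension K p} {γ : Field.absoluteGaloisGroup K}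
  {jbar : AlgebraicClosure K →+* ℂ} (D : (W.baseChange K).LambdaAdicSelmerData κ γ)
  (F : HeegnerFamily N W K κ jbar) (C : StabilizedHeegnerData N W K κ jbar) (e : ℕ)

/-- **REVERSE levelwise ⟹ Λ-adic.** Let `γ` be a topological generator. If `p^e • x ∈ ℋ̄_k(F)` for every
layer `k > δ` and every `x ∈ ℤ_p[Gal(K_k/K)]·κ_k(C)`, then `(ω_δ · p^e) • Λκ_∞(C) ≤ ℋ_∞(F)`,
`ω_δ = (1+T)^{p^δ} − 1`: for a spanning `s` of `Λκ_∞(C)`, the projection of `(ω_δ p^e) • s` to a layer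
`k ≤ δ` VANISHES (§2), and to a layer `k > δ` it is `conj_{γ^{p^δ}}(p^e • proj_k s) − p^e • proj_k s ∈ ℋ̄_k(F)`
(`hlev` and §1); so `(ω_δ p^e) • s` is a spanning element of `ℋ_∞(F)`.
[cite: CastellaGrossiLeeSkinner2022, Rem. 4.1.4 («generate the same Λ-submodule»)] [cite: PerrinRiou1987BSMF, §3.4] -/
theorem omega_mul_pow_smul_stabilizedHeegnerModule_le_heegnerModule_of_levelwise
    (hγ : κ.IsTopGenerator γ)
    (hlev : ∀ (k : ℕ) (hk : C.depth < k), ∀ x ∈ stabilizedModuleLayer γ C k hk,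
      ((p : ℤ) ^ e) • x ∈ heegnerModuleLayer γ F k) :
    (((((1 + PowerSeries.X : IwasawaAlgebra p) ^ (p ^ C.depth)) - 1) * (p : IwasawaAlgebra p) ^ e)) •
        stabilizedHeegnerModule D C ≤ heegnerModule D F := by
  have hCe : ((p : IwasawaAlgebra p) ^ e) = (PowerSeries.C ((((p : ℤ) ^ e : ℤ)) : ℤ_[p]) : IwasawaAlgebra p) := by
    rw [Int.cast_pow, Int.cast_natCast, map_pow, map_natCast]
  intro t ht
  obtain ⟨s, hs, rfl⟩ := (Submodule.mem_smul_pointwise_iff_exists _ _ _).mp ht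
  clear ht
  unfold stabilizedHeegnerModule at hs
  induction hs using Submodule.span_induction with
  | mem g hg =>
    refine Submodule.subset_span fun k ↦ ?_
    rw [mul_smul]
    by_cases hk : C.depth < k
    · -- layer above the depth: `conj_{γ^{p^δ}} y − y` with `y = p^e • proj_k g ∈ ℋ̄_k`
      have hy : ((p : ℤ) ^ e) • D.proj k g ∈ heegnerModuleLayer γ F k := hlev k hk _ (hg k hk)
      rw [sub_smul, one_smul, map_sub, proj_one_add_X_pow_smul, hCe, D.proj_C_intCast_smul]
      exact (heegnerModuleLayer γ F k).sub_mem (conjPi_pow_mem_heegnerModuleLayer γ F k _ hy) hy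
    · -- layer `k ≤ δ`: the projection vanishes
      rw [proj_one_add_X_pow_pow_sub_one_smul_of_le D hγ (not_lt.mp hk)]
      exact (heegnerModuleLayer γ F k).zero_mem
  | zero => rw [smul_zero]; exact Submodule.zero_mem _
  | add a b _ _ ha hb => rw [smul_add]; exact Submodule.add_mem _ ha hb
  | smul r a _ ha => rw [smul_comm]; exact Submodule.smul_mem _ r ha

/-- **Generators suffice (reverse)**: it is enough that `p^e • x ∈ ℋ̄_k(F)` for the representatives `x` of
CGLS's level class `δ(κ_k)` (`stabilizedClassLayer`), `k > δ` — `ℋ̄_k(F)` is `ℤ_p[G_k]`-stable (§1).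
[cite: CastellaGrossiLeeSkinner2022, Rem. 4.1.4 (κ_k)] [cite: Howard2004HeegnerKolyvagin, §3.3] -/
theorem omega_mul_pow_smul_stabilizedHeegnerModule_le_heegnerModule_of_generators
    (hγ : κ.IsTopGenerator γ)
    (hgen : ∀ (k : ℕ) (hk : C.depth < k), ∀ x ∈ stabilizedClassLayer C k hk,
      ((p : ℤ) ^ e) • x ∈ heegnerModuleLayer γ F k) :
    (((((1 + PowerSeries.X : IwasawaAlgebra p) ^ (p ^ C.depth)) - 1) * (p : IwasawaAlgebra p) ^ e)) •
        stabilizedHeegnerModule D C ≤ heegnerModule D F := by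
  refine omega_mul_pow_smul_stabilizedHeegnerModule_le_heegnerModule_of_levelwise D F C e hγ
    fun k hk y hy ↦ ?_
  unfold stabilizedModuleLayer at hy
  induction hy using AddSubgroup.closure_induction with
  | mem z hz =>
    obtain ⟨c, i, x, hx, rfl⟩ := hz
    rw [← map_zsmul, ← map_zsmul]
    exact padicPi_mem_heegnerModuleLayer γ F k c (conjPi_pow_mem_heegnerModuleLayer γ F k i (hgen k hk x hx))
  | zero => rw [zsmul_zero]; exact AddSubgroup.zero_mem _
  | add a b _ _ ha hb => rw [zsmul_add]; exact AddSubgroup.add_mem _ ha hb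
  | neg a _ ha => rw [zsmul_neg]; exact AddSubgroup.neg_mem _ ha

end Reverse

/-! ## §4 The torsion clause -/

section Torsion

variable {p : ℕ} [Fact p.Prime]

/-- **Torsion of a quotient from a non-zero multiple of a non-zero submodule**: for `S` finitely generated,
torsion-free, of `finrank 1` over `Λ`, submodules `M ≠ ⊥` and `H`, and `g ≠ 0` with `g • M ≤ H`: `S ⧸ H`
is torsion (`g • m` is a torsion-free element of `H`; rank–nullity). [cite: PerrinRiou1987BSMF, §1 p. 405 (I(H_∞) non-zero iff H_∞ and 𝔖_p have the same rank 1)] -/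
theorem Module.isTorsion_quotient_of_smul_le {S : Type*} [AddCommGroup S]
    [_root_.Module (IwasawaAlgebra p) S] [Module.Finite (IwasawaAlgebra p) S]
    [NoZeroSMulDivisors (IwasawaAlgebra p) S] (hS1 : Module.finrank (IwasawaAlgebra p) S = 1)
    {M H : Submodule (IwasawaAlgebra p) S} (hM : M ≠ ⊥) {g : IwasawaAlgebra p} (hg : g ≠ 0)
    (hle : g • M ≤ H) : Module.IsTorsion (IwasawaAlgebra p) (S ⧸ H) := by
  obtain ⟨m, hmM, hm0⟩ := (Submodule.ne_bot_iff M).mp hM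
  have hz : ∀ b : IwasawaAlgebra p, b • (g • m) = 0 → b = 0 := fun b hb ↦ by
    rw [smul_smul] at hb
    exact (mul_eq_zero.mp ((smul_eq_zero.mp hb).resolve_right hm0)).resolve_right hg
  have htorL := Module.isTorsion_quotient_span_singleton_of_torsionFree_of_finrank_eq_one hS1 hz
  have hle' : Submodule.span (IwasawaAlgebra p) {g • m} ≤ H := by
    rw [Submodule.span_singleton_le_iff_mem]
    exact hle (Submodule.smul_mem_pointwise_smul _ _ _ hmM)
  intro x
  obtain ⟨s, rfl⟩ := Submodule.Quotient.mk_surjective _ x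
  obtain ⟨⟨b, hb⟩, hbs⟩ := @htorL (Submodule.Quotient.mk s)
  refine ⟨⟨b, hb⟩, ?_⟩
  rw [Submonoid.mk_smul, ← Submodule.Quotient.mk_smul, Submodule.Quotient.mk_eq_zero] at hbs ⊢
  exact hle' hbs

variable {N : ℕ} [NeZero N] {W : WeierstrassCurve ℚ} [W.IsGloballyMinimal] {K : Type u} [Field K]
  [NumberField K] {κ : ZpExtension K p} {γ : Field.absoluteGaloisGroup K}
  {jbar : AlgebraicClosure K →+* ℂ} (D : (W.baseChange K).LambdaAdicSelmerData κ γ)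
  (F : HeegnerFamily N W K κ jbar) (C : StabilizedHeegnerData N W K κ jbar) (e : ℕ)

/-- **The torsion clause of the envelope from the REVERSE levelwise membership**: if `𝔖 = D.S` is finitely
generated, torsion-free, of `Λ`-rank one, `Λκ_∞(C) ≠ 0` (CGLS 2022 Thm. 4.1.1 / Cornut–Vatsal, §3.3) and
`p^e • δ(κ_k)`-representatives lie in `ℋ̄_k(F)` for every `k > δ` (geometric half), then `𝔖/ℋ_∞(F)` is
`Λ`-torsion. [cite: CastellaGrossiLeeSkinner2022, Thm. 4.1.1 and §3.3] [cite: PerrinRiou1987BSMF, §1 p. 405] -/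
theorem isTorsion_quotient_heegnerModule_of_levelwise [Module.Finite (IwasawaAlgebra p) D.S]
    [NoZeroSMulDivisors (IwasawaAlgebra p) D.S] (hS1 : Module.finrank (IwasawaAlgebra p) D.S = 1)
    (hγ : κ.IsTopGenerator γ) (hne : stabilizedHeegnerModule D C ≠ ⊥)
    (hgen : ∀ (k : ℕ) (hk : C.depth < k), ∀ x ∈ stabilizedClassLayer C k hk,
      ((p : ℤ) ^ e) • x ∈ heegnerModuleLayer γ F k) :
    Module.IsTorsion (IwasawaAlgebra p) (D.S ⧸ heegnerModule D F) := by
  refine Module.isTorsion_quotient_of_smul_le hS1 hne ?_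
    (omega_mul_pow_smul_stabilizedHeegnerModule_le_heegnerModule_of_generators D F C e hγ hgen)
  have hp0 : (p : IwasawaAlgebra p) ≠ 0 := by
    rw [← map_natCast (PowerSeries.C (R := ℤ_[p])) p]
    exact (map_ne_zero_iff _ PowerSeries.C_injective).mpr (Nat.cast_ne_zero.mpr (Fact.out : p.Prime).ne_zero)
  refine mul_ne_zero ?_ (pow_ne_zero _ hp0)
  intro h
  have hc := congrArg (PowerSeries.map (IsLocalRing.residue ℤ_[p])) h
  rw [map_zero] at hc
  exact map_omega_ne_zero (p := p) C.depth hc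

end Torsion

end Literature.NumberTheory.EllipticCurves

end
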